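import Summits.ValiantsHypothesis.ValiantsHypothesis.Theorems.NcParseTreeValues
import HarnessLib

/-!
# The normal-form conversion along a shape: typing, size, references, evaluation invariant

LLS18 = Lagarde–Limaye–Srinivasan 2018. THIS FILE (no definitions) is the kernel of the
conversion `nfConv rot T P` of `NcParseTrees` (block `j` of `P.gates ++ [copy of the output]` =
`2N` product slots then `N` sum slots, `N = |nodes T|`): (§1) EVERY slot is `GateRot`-typed by
`T` under the 3N-periodic typing `nfTy` — `GateTyped` without rotations — UNCONDITIONALLY in `P`
(`nfBlocks_typed`), the output is typed at the root, the size is `3N(P.size+1)` (`size_nfConv`),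
and slots only read earlier blocks / the product slots of their own block (`nfBlock_refsBelow`);
(§2) the EVALUATION INVARIANT (`nfBlocks_values`, LLS18 §3 Proposition 7 made rotation-aware):
the sum slot `(j, i)` computes `ptValAt rot S_i (parse trees of gate j)` — the sum of the terms
of those parse trees of gate `j` whose shape is `∼ S_i`, `S_i` the subshape of `T` at node `i` —
whence `(nfConv rot T P).ncEval = ptValAt rot T (circuitPts P)` (`ncEval_nfConv`, NO hypothesis
on `P`). The product rule `ptValAt_pairPts_node` of `NcParseTreeValues` is what makes the two
product slots of a node `(l, r)` (straight, and rotated iff `l ≁ r`) add up correctly.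
MODEL: PRINT rotUPT (LLS18 §4) for a circuit P in the tree's syntax := every PARSE TREE of P —
obtained by keeping one summand of every sum gate and both factors of every product gate, recorded
as (shape, coefficient•monomial) — has a shape that is a ROTATION (rotSim true) of one shape T;
PRINT UPT := every parse tree has shape T. Formalised for circuits whose product gates have fan-in
1 or 2 (copies and binary products; weighted sums of any fan-in; NO `const` operands — in print
constants live on the + wires only, LLS18 p. 7); product fan-in ≥ 3 (allowed in print, removed by
LLS18 Lemma 8) is NOT covered (= option (c)); `nfConv rot T P` is GateRot-typed by T (GateTyped for
rot = false) UNCONDITIONALLY and computes the sum of those parse trees of P whose shape is ∼ T —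
hence P.ncEval itself exactly when P is print-rotUPT of class [[T]]; size 3(2|T|−1)(P.size+1). The
transfers' constants (LID_r: 2^((r+1)/3) ≤ 96·r·r·(s+1); PERM_(4r): same; print-UPT: 2^(r+1) ≤
24·r·(s+1)) are WEAKER than lidPoly_rot / ncPerPoly_rot / ncPerPoly_upt — the content is the
factorisation print-rotUPT → rot-NF → lidPoly_rot. NOT a new lower bound; 0 S-currency;
closes NO item; A_nc stmt-23446 / PerNotNcVP / VP ≠ VNP untouched.
[cite: LagardeLimayeSrinivasan2018, §3 Proposition 7, §4] [cite: LimayeMalodSrinivasan2016, §7]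
[cite: ArvindRaja2016, §5]
-/

noncomputable section

namespace Summit.ValiantsHypothesis.ValiantsHypothesis.Theorems.NcParseTreeNormalForm

set_option linter.dupNamespace false
open Literature.Computability.AlgebraicComplexity
  Literature.Computability.AlgebraicComplexity.ArithCircuit
  Summit.ValiantsHypothesis.ValiantsHypothesis.Theorems.NcAutomatonIntersection
  Summit.ValiantsHypothesis.ValiantsHypothesis.Theorems.NcUniqueParseTree
  Summit.ValiantsHypothesis.ValiantsHypothesis.Theorems.NcRotParseTree
  Summit.ValiantsHypothesis.ValiantsHypothesis.Theorems.NcSkewCombTypedPermanent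
  Summit.ValiantsHypothesis.ValiantsHypothesis.Theorems.NcParseTrees
  Summit.ValiantsHypothesis.ValiantsHypothesis.Theorems.NcParseTreeValues

universe u v

variable {R : Type u} [CommSemiring R] {σ : Type v}

/-! ### §1 Typing, size, reference discipline -/

/-- Helper: one block's slots under a slot typing `Ty`. [cite: LagardeLimayeSrinivasan2018, §3] -/
theorem nfBlock_slots (rot : Bool) (T : Shape) {Ty : List Bool → Gate R σ → Prop}
    (hP : ∀ j i b g, i < (nodes T).length → Ty ((nodes T).getD i []) (pslot rot T j i b g))
    (hS : ∀ j i g, i < (nodes T).length → Ty ((nodes T).getD i []) (sslot T j i g)) (j : ℕ)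
    (g : Gate R σ) (k : ℕ) (hk : k < (prodPart rot T j g ++ sumPart T j g).length) :
    Ty (nfTy T k) (prodPart rot T j g ++ sumPart T j g)[k] := by
  have hN : (prodPart rot T j g).length = 2 * (nodes T).length := by simp [prodPart]
  have hM : (sumPart T j g).length = (nodes T).length := by simp [sumPart]
  have hk' : k < 3 * (nodes T).length := by rw [List.length_append, hN, hM] at hk; omega
  unfold nfTy; rw [Nat.mod_eq_of_lt hk']
  by_cases h2 : k < 2 * (nodes T).length
  · rw [if_pos h2, List.getElem_append_left (by omega)]
    simpa [prodPart] using hP j (k / 2) (k % 2) g (by omega)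
  · rw [if_neg h2, List.getElem_append_right (by omega)]
    simpa [sumPart, hN] using hS j (k - 2 * (nodes T).length) g (by omega)

/-- Helper: all slots under `Ty` (3N-periodic types). [cite: LagardeLimayeSrinivasan2018, §3] -/
theorem nfBlocks_slots (rot : Bool) (T : Shape) {Ty : List Bool → Gate R σ → Prop}
    (h1 : ∀ j g k (hk : k < (prodPart rot T j g ++ sumPart T j g).length),
      Ty (nfTy T k) (prodPart rot T j g ++ sumPart T j g)[k]) :
    ∀ (gs : List (Gate R σ)) (j k : ℕ) (hk : k < (nfBlocks rot T j gs).length),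
      Ty (nfTy T k) (nfBlocks rot T j gs)[k]
  | [], _, k, hk => absurd hk (by simp [nfBlocks])
  | g :: gs, j, k, hk => by
    have hB : (prodPart rot T j g ++ sumPart T j g).length = 3 * (nodes T).length := by
      simp only [List.length_append, prodPart, sumPart, List.length_map, List.length_range]; omega
    change Ty (nfTy T k) ((prodPart rot T j g ++ sumPart T j g ++ nfBlocks rot T (j + 1) gs)[k]'hk)
    by_cases hlt : k < (prodPart rot T j g ++ sumPart T j g).length
    · rw [List.getElem_append_left hlt]; exact h1 j g k hlt
    rw [List.getElem_append_right (by omega), show nfTy T k = nfTy T (k - (prodPart rot T j g ++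
        sumPart T j g).length) by unfold nfTy; rw [hB, Nat.mod_eq_sub_mod (by omega)]]
    exact nfBlocks_slots rot T h1 gs (j + 1) _ _

/-- ★ Every gate of the conversion is rot-typed by `T`; without rotations, typed — for EVERY
circuit `P` (no hypothesis). MODEL clause: a structural fact about the conversion `nfConv` of the
print-rotUPT MODEL (module docstring); NOT a new lower bound, 0 S-currency, closes NO item,
PerNotNcVP / A_nc untouched; the transfers it feeds are WEAKER than `lidPoly_rot`.
[cite: LagardeLimayeSrinivasan2018, §3 Proposition 7, §4] -/
theorem nfBlocks_typed (rot : Bool) (T : Shape) (gs : List (Gate R σ)) :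
    (∀ k (hk : k < (nfBlocks rot T 0 gs).length),
      GateRot T (nfTy T) (nfTy T k) (nfBlocks rot T 0 gs)[k]) ∧
    ∀ k (hk : k < (nfBlocks false T 0 gs).length),
      GateTyped T (nfTy T) (nfTy T k) (nfBlocks false T 0 gs)[k] :=
  ⟨fun k hk => nfBlocks_slots rot T (nfBlock_slots rot T (Ty := GateRot T (nfTy T))
      (fun j _ b g hi => (pslot_rot rot T j hi b g).1)
      (fun j _ g hi => GateRot.of_gateTyped (sslot_typed T j hi g))) gs 0 k hk,
    fun k hk => nfBlocks_slots false T (nfBlock_slots false T (Ty := GateTyped T (nfTy T))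
      (fun j _ b g hi => (pslot_rot false T j hi b g).2) (fun j _ g hi => sslot_typed T j hi g))
      gs 0 k hk⟩

/-- The output reads the root sum slot of the last block. [cite: LagardeLimayeSrinivasan2018, §3] -/
theorem nfConv_output (rot : Bool) (T : Shape) (P : ArithCircuit R σ) :
    OpTyped T (nfTy T) [] (nfConv rot T P).output := by
  obtain ⟨h1, h2⟩ := length_nodes T
  have h := (nfTy_slot T P.gates.length 0 0 (by omega) (by omega)).2
  rw [nodes_getD_zero] at h
  exact OpTyped.gate (by simpa [sref] using h)

/-- ★ The size of the conversion: `3N(s+1)` gates, `N = 2|T| − 1`. MODEL clause: the size count of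
the conversion in the print-rotUPT MODEL (module docstring); NOT a new lower bound, 0 S-currency,
closes NO item, PerNotNcVP / A_nc untouched; the transferred constants are WEAKER than
`lidPoly_rot` / `ncPerPoly_rot`. [cite: LagardeLimayeSrinivasan2018, §3 Proposition 7] -/
theorem size_nfConv (rot : Bool) (T : Shape) (P : ArithCircuit R σ) :
    (nfConv rot T P).size = 3 * (nodes T).length * (P.size + 1) := by
  show (nfBlocks rot T 0 _).length = _
  rw [length_nfBlocks, List.length_append, List.length_singleton]
  rfl

/-- Helper: `sref N j' i < 3Nj` for `j' < j`, `i < N`. [cite: LagardeLimayeSrinivasan2018, §3] -/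
theorem sref_lt {N j' j i : ℕ} (hj : j' < j) (hi : i < N) : sref N j' i < 3 * N * j := by
  unfold sref
  exact (show _ < 3 * N * j' + 3 * N by omega).trans_le
    (by rw [← Nat.mul_succ]; exact Nat.mul_le_mul_left _ (Nat.succ_le_of_lt hj))

/-- Helper: `opConv` reads only EARLIER sum slots. [cite: LagardeLimayeSrinivasan2018, §3] -/
theorem opConv_refsBelow (T : Shape) (j : ℕ) {π : List Bool} (hπ : π ∈ nodes T) {n : ℕ}
    (hn : 3 * (nodes T).length * j ≤ n) (u : Operand R σ) : (opConv T j π u).RefsBelow n := by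
  cases u with
  | var x => simp only [opConv]; split <;> trivial
  | const c => trivial
  | gate j' =>
    simp only [opConv]
    split
    · next h => exact (sref_lt h (List.idxOf_lt_length_of_mem hπ)).trans_le hn
    · trivial

/-- Reference discipline: product slots of block `j` read below `3Nj`, sum slots below `3Nj + 2N`
(hence `ncGateValues_append_block` applies twice per block).
[cite: LagardeLimayeSrinivasan2018, §3 Proposition 7] -/
theorem nfBlock_refsBelow (rot : Bool) (T : Shape) (j : ℕ) (g : Gate R σ) :
    (∀ b ∈ prodPart rot T j g, ∀ u ∈ b.args, u.RefsBelow (3 * (nodes T).length * j)) ∧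
      ∀ b ∈ sumPart T j g, ∀ u ∈ b.args,
        u.RefsBelow (3 * (nodes T).length * j + 2 * (nodes T).length) := by
  have hm : ∀ {i : ℕ} {l r : Shape} (c : Bool), T.sub ((nodes T).getD i []) = some (.node l r) →
      (nodes T).getD i [] ++ [c] ∈ nodes T := fun c h =>
    mem_nodes_iff.2 (by rw [Shape.sub_sub h]; cases c <;> simp [Shape.sub, Shape.sub_nil])
  have h0 : ∀ (n : ℕ) (u : Operand R σ), u ∈ (Gate.sum ([] : List (R × Operand R σ))).args →
      u.RefsBelow n := fun n u h => by simp [Gate.args] at h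
  constructor
  · intro b hb u hu
    simp only [prodPart, List.mem_map, List.mem_range] at hb
    obtain ⟨q, -, rfl⟩ := hb
    rcases g with args | (_ | ⟨v, _ | ⟨v', _ | _⟩⟩) <;> try exact h0 _ u hu
    cases hT : T.sub ((nodes T).getD (q / 2) []) with
    | none => simp only [pslot, hT] at hu; exact h0 _ u hu
    | some S =>
      cases S with
      | leaf => simp only [pslot, hT] at hu; exact h0 _ u hu
      | node l r =>
        simp only [pslot, hT] at hu
        split_ifs at hu <;>
          simp only [Gate.args, List.mem_cons, List.not_mem_nil, or_false] at hu <;>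
          rcases hu with rfl | rfl <;> exact opConv_refsBelow T j (hm _ hT) (le_refl _) _
  · intro b hb u hu
    simp only [sumPart, List.mem_map, List.mem_range] at hb
    obtain ⟨i, hi, rfl⟩ := hb
    have hπ : (nodes T).getD i [] ∈ nodes T := by
      rw [List.getD_eq_getElem _ _ hi]; exact List.getElem_mem hi
    rcases g with args | (_ | ⟨v, _ | ⟨v', _ | _⟩⟩) <;> try exact h0 _ u hu
    · simp only [sslot, Gate.args, List.map_map, List.mem_map] at hu
      obtain ⟨a, -, rfl⟩ := hu
      exact opConv_refsBelow T j hπ (Nat.le_add_right _ _) _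
    · simp only [sslot, Gate.args, List.map_cons, List.map_nil, List.mem_singleton] at hu
      subst hu
      exact opConv_refsBelow T j hπ (Nat.le_add_right _ _) _
    · simp only [sslot, Gate.args, List.map_cons, List.map_nil, List.mem_cons, List.not_mem_nil,
        or_false] at hu
      rcases hu with rfl | rfl <;> (show _ < _; omega)

/-! ### §2 The evaluation invariant (LLS18 §3 Proposition 7, made rotation-aware) -/

/-- Converted operands evaluate to the filtered value of the operand's parse trees, given that the
earlier sum slots do. [cite: LagardeLimayeSrinivasan2018, §3 Proposition 7] -/
theorem opConv_ncEval (rot : Bool) (T : Shape) {j : ℕ} {π : List Bool} {S : Shape}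
    (hS : T.sub π = some S) {W : List (List (Shape × FreeAlgebra R σ))} (hW : W.length = j)
    {vals : List (FreeAlgebra R σ)}
    (hV : ∀ j' < j, ∀ π' S', T.sub π' = some S' →
      vals.getD (sref (nodes T).length j' ((nodes T).idxOf π')) 0 = ptValAt rot S' (W.getD j' []))
    (u : Operand R σ) : (opConv T j π u).ncEval vals = ptValAt rot S (opPts W u) := by
  cases u with
  | var x => cases S <;> simp [opConv, hS, opPts, ptValAt, rotSim, Operand.ncEval]
  | const c => simp [opConv, opPts, ptValAt, Operand.ncEval]
  | gate j' =>
    simp only [opConv, opPts]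
    split
    · next h => exact hV j' h π S hS
    · next h =>
      rw [List.getD_eq_default _ _ (by omega)]
      simp [Operand.ncEval, ptValAt]

/-- The two product slots of an internal node `i` of a binary product add up to the filtered value
of the paired parse trees (the product rule; Δ vs the sketch: the unused binder `i < N` is dropped,
the statement is stronger). [cite: LagardeLimayeSrinivasan2018, §3 Proposition 7, §4] -/
theorem pslot_ncEval (rot : Bool) (T : Shape) {j i : ℕ} {S : Shape}
    (hS : T.sub ((nodes T).getD i []) = some S) {W : List (List (Shape × FreeAlgebra R σ))}
    (hW : W.length = j) {vals : List (FreeAlgebra R σ)}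
    (hV : ∀ j' < j, ∀ π' S', T.sub π' = some S' →
      vals.getD (sref (nodes T).length j' ((nodes T).idxOf π')) 0 = ptValAt rot S' (W.getD j' []))
    (u u' : Operand R σ) :
    (pslot rot T j i 0 (Gate.prod [u, u'])).ncEval vals +
        (pslot rot T j i 1 (Gate.prod [u, u'])).ncEval vals =
      ptValAt rot S (pairPts (opPts W u) (opPts W u')) := by
  cases S with
  | leaf =>
    rw [ptValAt_pairPts_leaf]
    simp only [pslot, hS, Gate.ncEval, List.map_nil, List.sum_nil, add_zero]
  | node l r =>
    have hl : T.sub ((nodes T).getD i [] ++ [false]) = some l := by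
      rw [Shape.sub_sub hS]; simp [Shape.sub, Shape.sub_nil]
    have hr : T.sub ((nodes T).getD i [] ++ [true]) = some r := by
      rw [Shape.sub_sub hS]; simp [Shape.sub, Shape.sub_nil]
    rw [ptValAt_pairPts_node]
    by_cases hc : (rot && !rotSim rot l r) = true
    · simp only [pslot, hS, hc, Nat.one_ne_zero, if_true, if_false, Gate.ncEval, List.map_cons,
        List.map_nil, List.prod_cons, List.prod_nil, mul_one, opConv_ncEval rot T hl hW hV,
        opConv_ncEval rot T hr hW hV]
    · simp only [pslot, hS, hc, Nat.one_ne_zero, Bool.false_eq_true, if_true, if_false,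
        Gate.ncEval, List.map_cons, List.map_nil, List.prod_cons, List.prod_nil, mul_one,
        List.sum_nil, add_zero, opConv_ncEval rot T hl hW hV, opConv_ncEval rot T hr hW hV]

/-- A sum slot computes the filtered value of its gate's parse trees, given the earlier sum slots
and (binary product) the two product slots of its block (Δ vs the sketch: the unused binder
`i < N` is dropped, the statement is stronger).
[cite: LagardeLimayeSrinivasan2018, §3 Proposition 7] -/
theorem sslot_ncEval (rot : Bool) (T : Shape) {j i : ℕ} {S : Shape}
    (hS : T.sub ((nodes T).getD i []) = some S) {W : List (List (Shape × FreeAlgebra R σ))}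
    (hW : W.length = j) {vals : List (FreeAlgebra R σ)}
    (hV : ∀ j' < j, ∀ π' S', T.sub π' = some S' →
      vals.getD (sref (nodes T).length j' ((nodes T).idxOf π')) 0 = ptValAt rot S' (W.getD j' []))
    (g : Gate R σ)
    (hP : ∀ u u', g = Gate.prod [u, u'] →
      vals.getD (3 * (nodes T).length * j + 2 * i) 0 +
          vals.getD (3 * (nodes T).length * j + 2 * i + 1) 0 =
        ptValAt rot S (pairPts (opPts W u) (opPts W u'))) :
    (sslot T j i g).ncEval vals = ptValAt rot S (gatePts W g) := by
  have hop := opConv_ncEval rot T hS hW hV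
  rcases g with args | (_ | ⟨u, _ | ⟨u', _ | _⟩⟩)
  · simp only [sslot, gatePts, Gate.ncEval, List.map_map, Function.comp_def, hop, ptValAt_sumPts]
  · show (Gate.sum ([] : List (R × Operand R σ))).ncEval vals = ptValAt rot S []
    simp [Gate.ncEval, ptValAt]
  · simp only [sslot, gatePts, Gate.ncEval, List.map_cons, List.map_nil, List.sum_cons,
      List.sum_nil, add_zero, one_smul, hop]
  · simpa only [sslot, gatePts, Gate.ncEval, Operand.ncEval, List.map_cons, List.map_nil,
      List.sum_cons, List.sum_nil, add_zero, one_smul] using hP u u' rfl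
  · show (Gate.sum ([] : List (R × Operand R σ))).ncEval vals = ptValAt rot S []
    simp [Gate.ncEval, ptValAt]

/-- ★ THE EVALUATION INVARIANT: the sum slot `(j, i)` computes the sum of the terms of those parse
trees of gate `j` whose shape is `∼` the subshape of `T` at node `i`. MODEL clause: the semantic
kernel of the conversion in the print-rotUPT MODEL (module docstring); NOT a new lower bound,
0 S-currency, closes NO item, PerNotNcVP / A_nc untouched; what it feeds is WEAKER than
`lidPoly_rot`. [cite: LagardeLimayeSrinivasan2018, §3 Proposition 7, §4] -/
theorem nfBlocks_values (rot : Bool) (T : Shape) (gs : List (Gate R σ)) :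
    ∀ j < gs.length, ∀ i < (nodes T).length, ∀ S, T.sub ((nodes T).getD i []) = some S →
      (ncGateValues (nfBlocks rot T 0 gs)).getD (sref (nodes T).length j i) 0 =
        ptValAt rot S ((ptLists gs).getD j []) := by
  induction gs using List.reverseRecOn with
  | nil => intro j hj; simp at hj
  | append_singleton gs g ih =>
    have hl0 : (ncGateValues (nfBlocks rot T 0 gs)).length = 3 * (nodes T).length * gs.length := by
      simpa [length_nfBlocks] using (ncGateValues_append_getD (nfBlocks rot T 0 gs) []).1
    have hlP : (prodPart rot T gs.length g).length = 2 * (nodes T).length := by simp [prodPart]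
    have hA0 : ∀ j' < gs.length, ∀ π' S', T.sub π' = some S' →
        (ncGateValues (nfBlocks rot T 0 gs)).getD
          (sref (nodes T).length j' ((nodes T).idxOf π')) 0 =
          ptValAt rot S' ((ptLists gs).getD j' []) := by
      intro j' hj' π' S' h
      have hi := List.idxOf_lt_length_of_mem (mem_nodes_iff.2 ⟨S', h⟩)
      refine ih j' hj' _ hi S' ?_
      rw [List.getD_eq_getElem _ _ hi, List.getElem_idxOf hi]
      exact h
    have hP1 := ncGateValues_append_block (nfBlocks rot T 0 gs) (prodPart rot T gs.length g)
      (fun b hb u hu => by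
        rw [length_nfBlocks]; exact (nfBlock_refsBelow rot T gs.length g).1 b hb u hu)
    have hS2 := ncGateValues_append_block (nfBlocks rot T 0 gs ++ prodPart rot T gs.length g)
      (sumPart T gs.length g) (fun b hb u hu => by
        rw [List.length_append, length_nfBlocks, hlP]
        exact (nfBlock_refsBelow rot T gs.length g).2 b hb u hu)
    have hA1 : ∀ j' < gs.length, ∀ π' S', T.sub π' = some S' →
        (ncGateValues (nfBlocks rot T 0 gs) ++ (prodPart rot T gs.length g).map fun b =>
            b.ncEval (ncGateValues (nfBlocks rot T 0 gs))).getD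
          (sref (nodes T).length j' ((nodes T).idxOf π')) 0 =
          ptValAt rot S' ((ptLists gs).getD j' []) := by
      intro j' hj' π' S' h
      have hi := List.idxOf_lt_length_of_mem (mem_nodes_iff.2 ⟨S', h⟩)
      rw [List.getD_append _ _ _ _ (by rw [hl0]; exact sref_lt hj' hi)]
      exact hA0 j' hj' π' S' h
    intro j hj i hi S hS
    rw [List.length_append, List.length_singleton] at hj
    rw [nfBlocks_append, Nat.zero_add, ← List.append_assoc, hS2, hP1]
    rcases Nat.lt_or_ge j gs.length with hj' | hj'
    · rw [List.getD_append _ _ _ _ (by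
          rw [List.length_append, List.length_map, hl0, hlP]
          exact Nat.lt_of_lt_of_le (sref_lt hj' hi) (Nat.le_add_right _ _)),
        List.getD_append _ _ _ _ (by rw [hl0]; exact sref_lt hj' hi), ih j hj' i hi S hS,
        ptLists_getD_append gs [g] hj']
    · obtain rfl : j = gs.length := by omega
      have hPP : ∀ u u', g = Gate.prod [u, u'] →
          (ncGateValues (nfBlocks rot T 0 gs) ++ (prodPart rot T gs.length g).map fun b =>
              b.ncEval (ncGateValues (nfBlocks rot T 0 gs))).getD
              (3 * (nodes T).length * gs.length + 2 * i) 0 +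
            (ncGateValues (nfBlocks rot T 0 gs) ++ (prodPart rot T gs.length g).map fun b =>
              b.ncEval (ncGateValues (nfBlocks rot T 0 gs))).getD
              (3 * (nodes T).length * gs.length + 2 * i + 1) 0 =
          ptValAt rot S (pairPts (opPts (ptLists gs) u) (opPts (ptLists gs) u')) := by
        intro u u' hg
        have hx : ∀ c < 2, (ncGateValues (nfBlocks rot T 0 gs) ++
            (prodPart rot T gs.length g).map fun b =>
              b.ncEval (ncGateValues (nfBlocks rot T 0 gs))).getD
              (3 * (nodes T).length * gs.length + 2 * i + c) 0 =
            (pslot rot T gs.length i c g).ncEval (ncGateValues (nfBlocks rot T 0 gs)) := by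
          intro c hc
          rw [List.getD_append_right _ _ _ _ (by rw [hl0]; omega), hl0,
            show 3 * (nodes T).length * gs.length + 2 * i + c - 3 * (nodes T).length * gs.length =
              2 * i + c by omega, List.getD_eq_getElem?_getD, List.getElem?_map]
          simp only [prodPart, List.getElem?_map,
            List.getElem?_range (show 2 * i + c < 2 * (nodes T).length by omega),
            Option.map_some, Option.getD_some]
          rw [show (2 * i + c) / 2 = i by omega, show (2 * i + c) % 2 = c by omega]
        have hx0 := hx 0 (by omega)
        rw [Nat.add_zero] at hx0
        rw [hx0, hx 1 (by omega), hg]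
        exact pslot_ncEval rot T hS (length_ptLists gs) hA0 u u'
      rw [ptLists_append_singleton, List.getD_append_right _ _ _ _ (length_ptLists gs).le,
        length_ptLists, Nat.sub_self, List.getD_cons_zero,
        List.getD_append_right _ _ _ _ (by
          rw [List.length_append, List.length_map, hl0, hlP]; unfold sref; omega),
        List.length_append, List.length_map, hl0, hlP,
        show sref (nodes T).length gs.length i -
            (3 * (nodes T).length * gs.length + 2 * (nodes T).length) = i by unfold sref; omega,
        List.getD_eq_getElem?_getD, List.getElem?_map]
      simp only [sumPart, List.getElem?_map, List.getElem?_range hi, Option.map_some,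
        Option.getD_some]
      exact sslot_ncEval rot T hS (length_ptLists gs) hA1 g hPP

/-- ★ THE CONVERSION COMPUTES THE `T`-FILTERED PARSE-TREE SUM of `P` — for EVERY circuit `P`, no
hypothesis: `(nfConv rot T P).ncEval = ptValAt rot T (circuitPts P)`. MODEL clause: the semantic
kernel of the print-rotUPT MODEL (module docstring) — `P.ncEval` itself only for print-rotUPT `P`
of class `[[T]]` (next file); NOT a new lower bound, 0 S-currency, closes NO item, PerNotNcVP / A_nc
untouched; the transfers it feeds are WEAKER than `lidPoly_rot` / `ncPerPoly_rot` /
`ncPerPoly_upt`. [cite: LagardeLimayeSrinivasan2018, §3 Proposition 7, §4] -/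
theorem ncEval_nfConv (rot : Bool) (T : Shape) (P : ArithCircuit R σ) :
    (nfConv rot T P).ncEval = ptValAt rot T (circuitPts P) := by
  obtain ⟨hN, h1⟩ := length_nodes T
  have hv := nfBlocks_values rot T (P.gates ++ [Gate.prod [P.output]]) P.gates.length (by simp)
    0 (by omega) T (by rw [nodes_getD_zero]; exact Shape.sub_nil T)
  rw [ptLists_append_singleton, List.getD_append_right _ _ _ _ (length_ptLists P.gates).le,
    length_ptLists, Nat.sub_self, List.getD_cons_zero] at hv
  simpa [ArithCircuit.ncEval, nfConv, Operand.ncEval, sref, gatePts, circuitPts] using hv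

end Summit.ValiantsHypothesis.ValiantsHypothesis.Theorems.NcParseTreeNormalForm
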